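import Summits.AtomisticToContinuum.HydrodynamicLimit.Theorems.JParityClosureCollisionTightnessSweptTube
import Summits.AtomisticToContinuum.HydrodynamicLimit.Theorems.JParityClosureCollisionTightnessWindowPos
import HarnessLib

/-!
# `JParityClosure.CollisionTightness` (stmt-AtomisticToContinuum-13085), rung 0, step 4:
# the window bound under a homogeneous Gibbs law

Helper file (`--supports stmt-AtomisticToContinuum-13085`).  For `N + 1` hard spheres of diameter
`ε_N = σ (N+1)^{-1/3}` on `𝕋³` under the homogeneous Gibbs law `G_N = localGibbsMeasure σ a ū θ N`
(`a, θ > 0`, `0 < σ ≤ 1/4`):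

* `measure_pairSet_le` — for labels `i ≠ j` and a jointly measurable family `S u ⊆ ℝ³` with
  `vol (S u) ≤ 4 ε² h ‖u‖`, `G_N{∃ k, reprSym (xᵢ − xⱼ) + k ∈ S (vᵢ − vⱼ)} ≤ 16 ε² h E_γ‖w − ū‖`
  (disintegration `lintegral_localGibbsMeasure`, dropping the hard-core constraints of sphere `i`,
  `lintegral_pos_window_le`, `volume_posDomain_le_two_mul`, `lintegral_enorm_vel_sub_le`);
* `exists_windowSet` — **the window bound**: a measurable `B ⊆` phase space with
  `G_N(B) ≤ 16 (N+1)² ε_N² h · E_γ‖w − ū‖` containing every non-overlapping configuration in which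
  some pair, flying freely, comes into contact at a time of `[0, h]` (`exists_sweptTube`,
  `exists_lift_of_contact`).  With `(N+1) ε_N³ = σ³` this is `16 σ² (N+1)^{4/3} h E‖w − ū‖`, the
  Boltzmann collision-frequency scale at fixed reduced density;
* `exists_freeFlight_contact_of_collision(_shift)` — kinematics on good orbits of a `HardSphereFlow`: a
  collision time in a window `[a, a + h]` forces a free-flight contact of some pair within `[0, h]`
  from `Φ_a z` (first collision time of the window, `IsHardSphereTrajectory.free`, continuity of
  positions, group property of the flow) — so the window set captures every window with a collision.

References: C. Cercignani, R. Illner, M. Pulvirenti, *The Mathematical Theory of Dilute Gases*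
(1994), App. 4.A; N. Chernov, J. Stat. Phys. 88 (1997) 1–29.
-/

noncomputable section

open MeasureTheory Set Filter Topology
open scoped ENNReal InnerProductSpace

namespace Summit.AtomisticToContinuum.HydrodynamicLimit.Theorems

open Literature.Analysis.FluidPDE Literature.MathematicalPhysics.KineticTheory
open Literature.Analysis.FunctionSpaces

/-- **The pair bound.** Under the homogeneous Gibbs law `G_N = localGibbsMeasure σ a ū θ N`
(`a, θ > 0`, `0 < σ ≤ 1/4`), for labels `i ≠ j` and a jointly measurable family `S u ⊆ ℝ³` with
`vol (S u) ≤ 4 ε² h ‖u‖`, the event "some lift of the relative position of `i, j` lies in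
`S (vᵢ − vⱼ)`" has probability at most `16 ε² h · E_γ‖w − ū‖`: disintegrate `G_N` into positions and
independent Gaussian velocities (`lintegral_localGibbsMeasure`), drop the hard-core constraints of
sphere `i`, integrate `xᵢ` first (`lintegral_pos_window_le`), compare partition functions
(`volume_posDomain_le_two_mul`) and take the velocity expectation (`lintegral_enorm_vel_sub_le`).
[folklore] -/
theorem measure_pairSet_le {a θ : ℝ} (ha : 0 < a) (hθ : 0 < θ) (ubar : V3) {σ : ℝ} (hσ : 0 < σ)
    (hσ4 : σ ≤ 1 / 4) (N : ℕ) {i j : Fin (N + 1)} (hij : i ≠ j) {h : ℝ} (hh : 0 ≤ h)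
    {S : V3 → Set V3} (hSm : MeasurableSet {q : V3 × V3 | q.1 ∈ S q.2})
    (hSvol : ∀ u, volume (S u) ≤ ENNReal.ofReal (4 * hsDiameter σ N ^ 2 * h * ‖u‖)) :
    localGibbsMeasure σ (fun _ => a) (fun _ => ubar) (fun _ => θ) N
        {z | ∃ k : Fin 3 → ℤ, Torus.reprSym ((z i).1 - (z j).1) + Torus.latticeVec k ∈
          S ((z i).2 - (z j).2)} ≤
      ENNReal.ofReal (16 * hsDiameter σ N ^ 2 * h) * ∫⁻ w, ‖w - ubar‖ₑ ∂gaussMeasure ubar θ := by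
  set ε := hsDiameter σ N with hε
  have hε0 : 0 < ε := hsDiameter_pos hσ N
  have hσ2 : σ ≤ 1 / 2 := hσ4.trans (by norm_num)
  obtain ⟨j', rfl⟩ := Fin.exists_succAbove_eq hij.symm
  -- measurability of the sections `S u` and of the joint sets
  have hSu : ∀ u : V3, MeasurableSet (S u) := fun u =>
    hSm.preimage (measurable_id.prodMk measurable_const)
  obtain ⟨M, hM⟩ : ∃ M : Set (Config (N + 1) (Fin 3) T3), M = {z | ∃ k : Fin 3 → ℤ,
      Torus.reprSym ((z i).1 - (z (i.succAbove j')).1) + Torus.latticeVec k ∈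
        S ((z i).2 - (z (i.succAbove j')).2)} := ⟨_, rfl⟩
  have hMm : MeasurableSet M := by
    have : M = ⋃ k : Fin 3 → ℤ, (fun z : Config (N + 1) (Fin 3) T3 =>
        (Torus.reprSym ((z i).1 - (z (i.succAbove j')).1) + Torus.latticeVec k,
          (z i).2 - (z (i.succAbove j')).2)) ⁻¹' {q : V3 × V3 | q.1 ∈ S q.2} := by
      rw [hM]; ext z; simp
    rw [this]
    refine MeasurableSet.iUnion fun k => hSm.preimage ?_
    refine Measurable.prodMk ?_
      ((measurable_pi_apply i).snd.sub (measurable_pi_apply (i.succAbove j')).snd)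
    exact (Torus.measurable_reprSym.comp
      ((measurable_pi_apply i).fst.sub (measurable_pi_apply (i.succAbove j')).fst)).add_const _
  -- the joint (position, velocity) set and integrand after dropping the constraints of sphere `i`
  obtain ⟨J, hJ⟩ : ∃ J : Set ((Fin (N + 1) → T3) × (Fin (N + 1) → V3)),
      J = {p | ∃ k : Fin 3 → ℤ, Torus.reprSym (p.1 i - p.1 (i.succAbove j')) + Torus.latticeVec k ∈
        S (p.2 i - p.2 (i.succAbove j'))} := ⟨_, rfl⟩
  have hJm : MeasurableSet J := by
    have : J = ⋃ k : Fin 3 → ℤ, (fun p : (Fin (N + 1) → T3) × (Fin (N + 1) → V3) =>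
        (Torus.reprSym (p.1 i - p.1 (i.succAbove j')) + Torus.latticeVec k,
          p.2 i - p.2 (i.succAbove j'))) ⁻¹' {q : V3 × V3 | q.1 ∈ S q.2} := by
      rw [hJ]; ext p; simp
    rw [this]
    refine MeasurableSet.iUnion fun k => hSm.preimage ?_
    have h1 : Measurable fun p : (Fin (N + 1) → T3) × (Fin (N + 1) → V3) =>
        p.1 i - p.1 (i.succAbove j') :=
      ((measurable_pi_apply i).comp measurable_fst).sub
        ((measurable_pi_apply (i.succAbove j')).comp measurable_fst)
    have h2 : Measurable fun p : (Fin (N + 1) → T3) × (Fin (N + 1) → V3) =>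
        p.2 i - p.2 (i.succAbove j') :=
      ((measurable_pi_apply i).comp measurable_snd).sub
        ((measurable_pi_apply (i.succAbove j')).comp measurable_snd)
    exact ((Torus.measurable_reprSym.comp h1).add_const _).prodMk h2
  -- volumes of the non-overlap sets
  set Vn := volume (posDomain ε (N + 1)) with hVn
  set VN := volume (posDomain ε N) with hVN
  have hZ : canonicalPartition (Torus.geometry (Fin 3)) ε (N + 1)
      (localGibbsProfile (fun _ => a) (fun _ => ubar) (fun _ => θ)) = a ^ (N + 1) * Vn.toReal := by
    rw [canonicalPartition_eq_posPartition continuous_const continuous_const continuous_const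
      (fun _ => ha.le) (fun _ => hθ) ε (N + 1), posPartition_const]
  have hZpos : 0 < a ^ (N + 1) * Vn.toReal := by
    rw [← posPartition_const, hε]
    exact posPartition_pos continuous_const (fun _ => ha) hσ2 N
  have hVn_top : Vn ≠ ⊤ := (measure_lt_top _ _).ne
  have hVn_pos : Vn ≠ 0 := by
    intro h0
    rw [h0, ENNReal.toReal_zero, mul_zero] at hZpos
    exact lt_irrefl _ hZpos
  have hcoef : ENNReal.ofReal ((a ^ (N + 1) * Vn.toReal)⁻¹ * a ^ (N + 1)) = Vn⁻¹ := by
    have han : (0 : ℝ) < a ^ (N + 1) := pow_pos ha _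
    have hVr : 0 < Vn.toReal := ENNReal.toReal_pos hVn_pos hVn_top
    rw [show (a ^ (N + 1) * Vn.toReal)⁻¹ * a ^ (N + 1) = (Vn.toReal)⁻¹ by field_simp,
      ENNReal.ofReal_inv_of_pos hVr, ENNReal.ofReal_toReal hVn_top]
  have hratio : VN ≤ 2 * Vn := volume_posDomain_le_two_mul hσ hσ4 N i
  -- the velocity law
  set Γ : Measure (Fin (N + 1) → V3) := Measure.pi fun _ : Fin (N + 1) => gaussMeasure ubar θ with hΓ
  -- Step 1: the Gibbs probability as an iterated integral, bounded by the relaxed integrand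
  set Φ : (Fin (N + 1) → T3) → (Fin (N + 1) → V3) → ℝ≥0∞ := fun x v =>
    Vn⁻¹ * ((posDomain ε N).indicator 1 (Fin.removeNth i x) * J.indicator 1 (x, v)) with hΦ
  have hΦm : Measurable (Function.uncurry Φ) := by
    refine measurable_const.mul (Measurable.mul ?_ (measurable_one.indicator hJm))
    exact (measurable_one.indicator (measurableSet_posDomain ε N)).comp
      ((measurable_pi_lambda _ fun k => measurable_pi_apply _).comp measurable_fst)
  have hstep1 : localGibbsMeasure σ (fun _ => a) (fun _ => ubar) (fun _ => θ) N M ≤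
      ∫⁻ x, ∫⁻ v, Φ x v ∂Γ := by
    rw [← lintegral_indicator_one hMm,
      lintegral_localGibbsMeasure continuous_const continuous_const continuous_const
        (fun _ => ha.le) (fun _ => hθ) σ N (measurable_one.indicator hMm)]
    refine lintegral_mono fun x => ?_
    have hvel : velMeasure (fun _ : T3 => ubar) (fun _ : T3 => θ) x = Γ := rfl
    have hmeasv : Measurable fun v : Fin (N + 1) → V3 =>
        M.indicator (1 : Config (N + 1) (Fin 3) T3 → ℝ≥0∞) (zipConfig (x, v)) :=
      (measurable_one.indicator hMm).comp
        (measurable_zipConfig.comp (measurable_const.prodMk measurable_id))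
    rw [hvel, hZ, ← lintegral_const_mul _ hmeasv]
    refine lintegral_mono fun v => ?_
    -- pointwise comparison
    rw [posWeight_const]
    by_cases hx : x ∈ posDomain ε (N + 1)
    · rw [indicator_of_mem hx, hcoef]
      simp only [hΦ]
      have hrem : Fin.removeNth i x ∈ posDomain ε N := by
        intro a' b' hab
        exact hx _ _ fun h => hab (Fin.succAbove_right_injective h)
      rw [indicator_of_mem hrem, Pi.one_apply, one_mul]
      gcongr
      by_cases hz : zipConfig (x, v) ∈ M
      · rw [indicator_of_mem hz]
        have hxv : (x, v) ∈ J := by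
          rw [hJ]; rw [hM] at hz
          simpa [zipConfig_apply] using hz
        rw [indicator_of_mem hxv]
        exact le_rfl
      · rw [indicator_of_notMem hz]
        exact bot_le
    · rw [indicator_of_notMem hx, mul_zero, ENNReal.ofReal_zero, zero_mul]
      exact bot_le
  -- Step 2: swap the integrals
  have hstep2 : ∫⁻ x, ∫⁻ v, Φ x v ∂Γ = ∫⁻ v, ∫⁻ x, Φ x v ∂volume ∂Γ :=
    lintegral_lintegral_swap hΦm.aemeasurable
  -- Step 3: the position integral for a fixed velocity vector
  have hstep3 : ∀ v : Fin (N + 1) → V3, ∫⁻ x, Φ x v ∂volume ≤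
      ENNReal.ofReal (8 * ε ^ 2 * h) * ‖v i - v (i.succAbove j')‖ₑ := by
    intro v
    set u : V3 := v i - v (i.succAbove j') with hu
    have hsec : (fun x => Φ x v) = fun x => Vn⁻¹ * ((posDomain ε N).indicator 1 (Fin.removeNth i x) *
        {x' : Fin (N + 1) → T3 | ∃ k : Fin 3 → ℤ,
          Torus.reprSym (x' i - x' (i.succAbove j')) + Torus.latticeVec k ∈ S u}.indicator 1 x) := by
      funext x
      simp only [hΦ]
      congr 2
      rw [hJ]
      rfl
    rw [hsec, lintegral_const_mul' _ _ (ENNReal.inv_ne_top.2 hVn_pos)]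
    calc Vn⁻¹ * ∫⁻ x, (posDomain ε N).indicator 1 (Fin.removeNth i x) *
          {x' : Fin (N + 1) → T3 | ∃ k : Fin 3 → ℤ,
            Torus.reprSym (x' i - x' (i.succAbove j')) + Torus.latticeVec k ∈ S u}.indicator 1 x
        ≤ Vn⁻¹ * (volume (S u) * VN) := by
          gcongr
          exact lintegral_pos_window_le i j' (hSu u)
      _ ≤ Vn⁻¹ * (ENNReal.ofReal (4 * ε ^ 2 * h * ‖u‖) * (2 * Vn)) := by
          gcongr
          exact hSvol u
      _ = ENNReal.ofReal (4 * ε ^ 2 * h * ‖u‖) * 2 * (Vn⁻¹ * Vn) := by ring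
      _ = ENNReal.ofReal (8 * ε ^ 2 * h) * ‖u‖ₑ := by
          rw [ENNReal.inv_mul_cancel hVn_pos hVn_top, mul_one, mul_two,
            ← ENNReal.ofReal_add (by positivity) (by positivity), ← ofReal_norm,
            ← ENNReal.ofReal_mul (by positivity)]
          congr 1
          ring
  -- Step 4: the velocity expectation
  calc localGibbsMeasure σ (fun _ => a) (fun _ => ubar) (fun _ => θ) N
        {z | ∃ k : Fin 3 → ℤ, Torus.reprSym ((z i).1 - (z (i.succAbove j')).1) + Torus.latticeVec k ∈
          S ((z i).2 - (z (i.succAbove j')).2)}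
      = localGibbsMeasure σ (fun _ => a) (fun _ => ubar) (fun _ => θ) N M := by rw [hM]
    _ ≤ ∫⁻ x, ∫⁻ v, Φ x v ∂Γ := hstep1
    _ = ∫⁻ v, ∫⁻ x, Φ x v ∂volume ∂Γ := hstep2
    _ ≤ ∫⁻ v, ENNReal.ofReal (8 * ε ^ 2 * h) * ‖v i - v (i.succAbove j')‖ₑ ∂Γ :=
        lintegral_mono hstep3
    _ = ENNReal.ofReal (8 * ε ^ 2 * h) * ∫⁻ v, ‖v i - v (i.succAbove j')‖ₑ ∂Γ := by
        rw [lintegral_const_mul _ (by fun_prop)]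
    _ ≤ ENNReal.ofReal (8 * ε ^ 2 * h) * (2 * ∫⁻ w, ‖w - ubar‖ₑ ∂gaussMeasure ubar θ) := by
        gcongr
        exact lintegral_enorm_vel_sub_le ubar θ i (i.succAbove j')
    _ = ENNReal.ofReal (16 * ε ^ 2 * h) * ∫⁻ w, ‖w - ubar‖ₑ ∂gaussMeasure ubar θ := by
        rw [two_mul, mul_add, ← add_mul, ← ENNReal.ofReal_add (by positivity) (by positivity)]
        congr 2
        ring

/-- **The window bound** (step `G_N(collision possible within h) = O((N+1)² ε² h)` of the mean
collision number).  Under the homogeneous Gibbs law `G_N = localGibbsMeasure σ a ū θ N` (`a, θ > 0`,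
`0 < σ ≤ 1/4`) there is, for every window length `h ≥ 0`, a measurable set `B` of phase space with
`G_N(B) ≤ 16 (N+1)² ε_N² h · E_γ‖w − ū‖` containing every non-overlapping configuration in which
some pair of spheres, flying freely, comes into contact at some time of `[0, h]` — in particular
(companion file) every good configuration whose hard-sphere orbit has a collision in `[0, h]`.
Since `(N+1) ε_N³ = σ³`, the bound is `16 σ² (N+1)^{4/3} h E‖w − ū‖`: the Boltzmann collision
frequency scale. [folklore] -/
theorem exists_windowSet {a θ : ℝ} (ha : 0 < a) (hθ : 0 < θ) (ubar : V3) {σ : ℝ} (hσ : 0 < σ)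
    (hσ4 : σ ≤ 1 / 4) (N : ℕ) {h : ℝ} (hh : 0 ≤ h) :
    ∃ B : Set (Config (N + 1) (Fin 3) T3), MeasurableSet B ∧
      localGibbsMeasure σ (fun _ => a) (fun _ => ubar) (fun _ => θ) N B ≤
        ENNReal.ofReal (16 * ((N : ℝ) + 1) ^ 2 * hsDiameter σ N ^ 2 * h) *
          ∫⁻ w, ‖w - ubar‖ₑ ∂gaussMeasure ubar θ ∧
      ∀ z ∈ hardSphereDomain (Torus.geometry (Fin 3)) (N + 1) (hsDiameter σ N),
        ∀ i j : Fin (N + 1), i ≠ j → ∀ t ∈ Icc 0 h,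
          Torus.euclidDist ((z i).1 + Torus.proj (t • (z i).2)) ((z j).1 + Torus.proj (t • (z j).2)) =
            hsDiameter σ N → z ∈ B := by
  set ε := hsDiameter σ N with hε
  have hε0 : 0 < ε := hsDiameter_pos hσ N
  obtain ⟨S, hSm, hSvol, hSmem⟩ := exists_sweptTube hε0 hh
  obtain ⟨M, hM⟩ : ∃ M : Fin (N + 1) → Fin (N + 1) → Set (Config (N + 1) (Fin 3) T3),
      M = fun i j => {z | ∃ k : Fin 3 → ℤ,
        Torus.reprSym ((z i).1 - (z j).1) + Torus.latticeVec k ∈ S ((z i).2 - (z j).2)} := ⟨_, rfl⟩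
  have hMm : ∀ i j, MeasurableSet (M i j) := by
    intro i j
    have : M i j = ⋃ k : Fin 3 → ℤ, (fun z : Config (N + 1) (Fin 3) T3 =>
        (Torus.reprSym ((z i).1 - (z j).1) + Torus.latticeVec k, (z i).2 - (z j).2)) ⁻¹'
          {q : V3 × V3 | q.1 ∈ S q.2} := by
      rw [hM]; ext z; simp
    rw [this]
    refine MeasurableSet.iUnion fun k => hSm.preimage ?_
    refine Measurable.prodMk ?_ ((measurable_pi_apply i).snd.sub (measurable_pi_apply j).snd)
    exact (Torus.measurable_reprSym.comp
      ((measurable_pi_apply i).fst.sub (measurable_pi_apply j).fst)).add_const _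
  set c : ℝ≥0∞ := ENNReal.ofReal (16 * ε ^ 2 * h) * ∫⁻ w, ‖w - ubar‖ₑ ∂gaussMeasure ubar θ with hc
  have hpair : ∀ i j, localGibbsMeasure σ (fun _ => a) (fun _ => ubar) (fun _ => θ) N
      (⋃ (_ : i ≠ j), M i j) ≤ c := by
    intro i j
    by_cases hij : i ≠ j
    · calc localGibbsMeasure σ (fun _ => a) (fun _ => ubar) (fun _ => θ) N (⋃ (_ : i ≠ j), M i j)
          ≤ localGibbsMeasure σ (fun _ => a) (fun _ => ubar) (fun _ => θ) N (M i j) :=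
            measure_mono (iUnion_subset fun _ => subset_rfl)
        _ ≤ c := by
            rw [hM]
            exact measure_pairSet_le ha hθ ubar hσ hσ4 N hij hh hSm hSvol
    · calc localGibbsMeasure σ (fun _ => a) (fun _ => ubar) (fun _ => θ) N (⋃ (_ : i ≠ j), M i j)
          ≤ localGibbsMeasure σ (fun _ => a) (fun _ => ubar) (fun _ => θ) N ∅ :=
            measure_mono (iUnion_subset fun hne => (hij hne).elim)
        _ ≤ c := by rw [measure_empty]; exact bot_le
  refine ⟨⋃ i, ⋃ j, ⋃ (_ : i ≠ j), M i j,
    MeasurableSet.iUnion fun i => MeasurableSet.iUnion fun j =>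
      MeasurableSet.iUnion fun _ => hMm i j, ?_, ?_⟩
  · calc localGibbsMeasure σ (fun _ => a) (fun _ => ubar) (fun _ => θ) N (⋃ i, ⋃ j, ⋃ (_ : i ≠ j), M i j)
        ≤ ∑ i, localGibbsMeasure σ (fun _ => a) (fun _ => ubar) (fun _ => θ) N
            (⋃ j, ⋃ (_ : i ≠ j), M i j) := measure_iUnion_fintype_le _ _
      _ ≤ ∑ i, ∑ j, localGibbsMeasure σ (fun _ => a) (fun _ => ubar) (fun _ => θ) N
            (⋃ (_ : i ≠ j), M i j) :=
          Finset.sum_le_sum fun i _ => measure_iUnion_fintype_le _ _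
      _ ≤ ∑ _i : Fin (N + 1), ∑ _j : Fin (N + 1), c :=
          Finset.sum_le_sum fun i _ => Finset.sum_le_sum fun j _ => hpair i j
      _ = ENNReal.ofReal (16 * ((N : ℝ) + 1) ^ 2 * ε ^ 2 * h) *
            ∫⁻ w, ‖w - ubar‖ₑ ∂gaussMeasure ubar θ := by
          simp only [Finset.sum_const, Finset.card_univ, Fintype.card_fin, nsmul_eq_mul]
          have hN : ((N + 1 : ℕ) : ℝ≥0∞) = ENNReal.ofReal ((N : ℝ) + 1) := by
            rw [← ENNReal.ofReal_natCast]
            push_cast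
            rfl
          rw [hc, hN, ← mul_assoc, ← mul_assoc, ← ENNReal.ofReal_mul (by positivity),
            ← ENNReal.ofReal_mul (by positivity)]
          congr 2
          ring
  · intro z hz i j hij t ht hcontact
    have hD : ε ≤ Torus.euclidDist (z i).1 (z j).1 := hz i j hij
    obtain ⟨k, hk1, hk2⟩ := exists_lift_of_contact hD hcontact
    have hmem : Torus.reprSym ((z i).1 - (z j).1) + Torus.latticeVec k ∈ S ((z i).2 - (z j).2) :=
      hSmem _ _ t hk1 ht hk2
    refine mem_iUnion.2 ⟨i, mem_iUnion.2 ⟨j, mem_iUnion.2 ⟨hij, ?_⟩⟩⟩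
    rw [hM]
    exact ⟨k, hmem⟩

/-! ### Kinematics: a collision in a window forces a free-flight contact from the window's start -/

/-- **First collision of a window.** For a good initial datum whose hard-sphere orbit has a collision
time in `[0, h]`, some pair of spheres, flying FREELY from the initial datum, is in contact at some
time of `[0, h]`: before the first collision time `t₁` of the window the orbit is the free flight
(`IsHardSphereTrajectory.free`), positions are continuous (`pos_continuous`), and at `t₁` a pair is in
contact. [folklore] -/
theorem exists_freeFlight_contact_of_collision {ε : ℝ} {N : ℕ}
    (Φ : HardSphereFlow (Torus.geometry (Fin 3)) ε N) {z : Config N (Fin 3) T3} (hz : z ∈ Φ.good)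
    {h t : ℝ} (ht : t ∈ Icc 0 h)
    (htc : t ∈ collisionTimes (Torus.geometry (Fin 3)) ε (fun s => Φ.flow s z)) :
    ∃ i j : Fin N, i ≠ j ∧ ∃ s ∈ Icc 0 h,
      Torus.euclidDist ((z i).1 + Torus.proj (s • (z i).2)) ((z j).1 + Torus.proj (s • (z j).2)) = ε := by
  set γ : ℝ → Config N (Fin 3) T3 := fun s => Φ.flow s z with hγ
  have htraj : IsHardSphereTrajectory (Torus.geometry (Fin 3)) ε N γ := Φ.isTrajectory z hz
  have hfin : (collisionTimes (Torus.geometry (Fin 3)) ε γ ∩ Icc 0 h).Finite := htraj.locFinite 0 h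
  have hne : hfin.toFinset.Nonempty := ⟨t, hfin.mem_toFinset.2 ⟨htc, ht⟩⟩
  set t₁ := hfin.toFinset.min' hne with ht₁
  have ht₁mem : t₁ ∈ collisionTimes (Torus.geometry (Fin 3)) ε γ ∩ Icc 0 h :=
    hfin.mem_toFinset.1 (Finset.min'_mem _ hne)
  have ht₁min : ∀ s ∈ collisionTimes (Torus.geometry (Fin 3)) ε γ ∩ Icc 0 h, t₁ ≤ s := fun s hs =>
    Finset.min'_le _ _ (hfin.mem_toFinset.2 hs)
  obtain ⟨i, j, hij, hcontact⟩ := mem_collisionTimes.1 ht₁mem.1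
  have ht₁0 : 0 ≤ t₁ := ht₁mem.2.1
  have ht₁h : t₁ ≤ h := ht₁mem.2.2
  -- positions at time `t₁` are the free-flight positions
  have hpos : ∀ l : Fin N, (γ t₁ l).1 = (z l).1 + Torus.proj (t₁ • (z l).2) := by
    intro l
    rcases ht₁0.eq_or_lt with h0 | h0pos
    · rw [← h0]
      simp only [hγ, Φ.flow_zero z hz, zero_smul, Torus.proj_zero, add_zero]
    · have hfree : ∀ s ∈ Ico 0 t₁, γ s = freeFlight (Torus.geometry (Fin 3)) s z := by
        intro s hs
        have h1 := htraj.free 0 s hs.1 (fun r hr hrc => ?_)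
        · rw [sub_zero] at h1
          rw [h1]
          simp only [hγ, Φ.flow_zero z hz]
        · have hrS : r ∈ collisionTimes (Torus.geometry (Fin 3)) ε γ ∩ Icc 0 h :=
            ⟨hrc, hr.1.le, hr.2.trans (hs.2.le.trans ht₁h)⟩
          exact absurd (ht₁min r hrS) (not_le.2 (hr.2.trans_lt hs.2))
      have hcont : Continuous fun s => (γ s l).1 := htraj.pos_continuous l
      have hg : Continuous fun s : ℝ => (z l).1 + Torus.proj (s • (z l).2) :=
        continuous_const.add (Torus.continuous_proj.comp (continuous_id.smul continuous_const))
      have h1 : Tendsto (fun s => (γ s l).1) (𝓝[<] t₁) (𝓝 ((γ t₁ l).1)) :=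
        (hcont.tendsto t₁).mono_left nhdsWithin_le_nhds
      have h2 : Tendsto (fun s : ℝ => (z l).1 + Torus.proj (s • (z l).2)) (𝓝[<] t₁)
          (𝓝 ((z l).1 + Torus.proj (t₁ • (z l).2))) :=
        (hg.tendsto t₁).mono_left nhdsWithin_le_nhds
      have heq : (fun s : ℝ => (z l).1 + Torus.proj (s • (z l).2)) =ᶠ[𝓝[<] t₁]
          fun s => (γ s l).1 := by
        filter_upwards [Ioo_mem_nhdsLT h0pos] with s hs
        rw [hfree s ⟨hs.1.le, hs.2⟩]
        rfl
      exact tendsto_nhds_unique h1 (h2.congr' heq)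
  refine ⟨i, j, hij, t₁, ⟨ht₁0, ht₁h⟩, ?_⟩
  have hc := (mem_contactSet.1 hcontact).2
  rw [Torus.norm_geometry_sepVec, hpos i, hpos j] at hc
  exact hc

/-- **A collision in the window `[a, a + h]`** forces a free-flight contact within `[0, h]` from the
configuration `Φ_a z` (group property of the flow and `exists_freeFlight_contact_of_collision`).
[folklore] -/
theorem exists_freeFlight_contact_of_collision_shift {ε : ℝ} {N : ℕ}
    (Φ : HardSphereFlow (Torus.geometry (Fin 3)) ε N) {z : Config N (Fin 3) T3} (hz : z ∈ Φ.good)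
    {a h t : ℝ} (ht : t ∈ Icc a (a + h))
    (htc : t ∈ collisionTimes (Torus.geometry (Fin 3)) ε (fun s => Φ.flow s z)) :
    ∃ i j : Fin N, i ≠ j ∧ ∃ s ∈ Icc 0 h,
      Torus.euclidDist ((Φ.flow a z i).1 + Torus.proj (s • (Φ.flow a z i).2))
        ((Φ.flow a z j).1 + Torus.proj (s • (Φ.flow a z j).2)) = ε := by
  have hw : Φ.flow a z ∈ Φ.good := Φ.mapsTo_good a hz
  refine exists_freeFlight_contact_of_collision Φ hw (t := t - a)
    ⟨by linarith [ht.1], by linarith [ht.2]⟩ ?_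
  rw [mem_collisionTimes] at htc ⊢
  have hflow : Φ.flow (t - a) (Φ.flow a z) = Φ.flow t z := by
    rw [← Φ.flow_add (t - a) a z hz, sub_add_cancel]
  simpa only [hflow] using htc


end Summit.AtomisticToContinuum.HydrodynamicLimit.Theorems

end
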